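import Summits.Ventures.HodgeRepro.Tier4.Line1.ThreeLines
import Summits.Ventures.HodgeRepro.Tier4.Line1.RationalRotation

/-!
# Tier4/Line1/LinRegular — LINE L1: linear regularity of the rational rotation (J2.d′-i, v0.17 form) (t4-L1-p3)

Blind re-derivation cell `pub-hodge-repro`, Tier 4 (README §9–§10), seat t4-L1-p3.  The line's v0.17 reading of
J2.d′-i (t4-plan-1 g1, STATUS.md S12586 (B), (B′)), over PlaneDefs v0.2 (`IsGenuineRow`, `IsLinRegular`):
* `mat_eq_scalar_of_three_lines'`: `ThreeLines.mat_eq_scalar_of_three_lines` for an arbitrary adelic matrix `Y`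
  commuting with `Ω` (the unitary `t` of the landed version was used only for `t Ω = Ω t`).
* `isLinRegular_of_no_shared_line` (S12586 (ii), statement verbatim): a rational point `γ₀` with rational matrix `g₀`
  and inverse `g₀'` is LINEARLY regular as soon as the line `im (g₀ Q₀ g₀')` is neither `P`-line — `Y γ₀ = γ₀ Y′`
  makes `Y` commute with `Ω`, `P 0`, `P 1` and with the rank-2 `Ω`-stable rational projector `g₀ Q₀ g₀'`, so `Y` is an
  `E′_𝔸`-scalar and `Y′ = γ₀⁻¹ Y γ₀` is the same scalar.
* `exists_regular_rational` (S12586 (B′)): for a definite, row-genuine plane a linearly regular rational point exists —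
  `γ₀ = 1` when `im (Q 0)` is neither `P`-line, the rational rotation of `RationalRotation.exists_rational_rotation`
  otherwise (it moves a vector of `im (Q 0)` to general position, so the conjugated line is neither `P`-line).
No Witt theorem, no density of rational points; Mathlib + the line's landed modules only.

Nothing here says anything about the status of the Hodge conjecture for CM abelian varieties, which is NOT proved
(HC_CM is NOT proved by anyone in this repository).
-/

set_option autoImplicit false

noncomputable section

namespace Summit.Ventures.HodgeRepro.Tier4.Line1

open NumberField Summit.Ventures.HodgeRepro.Tier4.Common Matrix

variable {k : Type} [Field k] [NumberField k] (W : PlaneData k)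

/-- `adMat` is injective (the structure map `k → 𝔸_k` is). -/
theorem adMat_injective {A A' : Matrix (Fin 4) (Fin 4) k} (h : adMat k A = adMat k A') : A = A' := by
  ext i j
  have := congrFun (congrFun h i) j
  simp only [adMat, Matrix.map_apply] at this
  exact NumberField.AdeleRing.algebraMap_injective (𝓞 k) k this

/-- **three lines force a scalar** for any adelic matrix commuting with `Ω` (not only a unitary). -/
theorem mat_eq_scalar_of_three_lines' {d : k} (hΩ : W.Ω * W.Ω = -(d • (1 : Matrix (Fin 4) (Fin 4) k)))
    (hd : ¬ IsSquare (-d)) (hP0 : (W.P 0).rank = 2) (hP1 : (W.P 1).rank = 2)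
    {f : Matrix (Fin 4) (Fin 4) k} (hfΩ : f * W.Ω = W.Ω * f) (hfr : f.rank = 2)
    {z : Fin 4 → k} (hzf : z ∈ LinearMap.range f.mulVecLin)
    (hx : W.P 0 *ᵥ z ≠ 0) (hy : W.P 1 *ᵥ z ≠ 0)
    (M : M4 k) (hMΩ : M * adMat k W.Ω = adMat k W.Ω * M)
    (ht0 : M * adMat k (W.P 0) = adMat k (W.P 0) * M)
    (ht1 : M * adMat k (W.P 1) = adMat k (W.P 1) * M)
    (htf : M * adMat k f = adMat k f * M) :
    ∃ c e : Ad k, M = c • (1 : M4 k) + e • adMat k W.Ω := by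
  set ι := algebraMap k (Ad k) with hι
  have hz : z ≠ 0 := by
    intro h
    apply hx
    rw [h, mulVec_zero]
  have hspanf := range_le_span_pair W hΩ hd hfΩ hfr hz hzf
  have hxP : W.P 0 *ᵥ z ∈ LinearMap.range (W.P 0).mulVecLin := ⟨z, rfl⟩
  have hyP : W.P 1 *ᵥ z ∈ LinearMap.range (W.P 1).mulVecLin := ⟨z, rfl⟩
  have hspan0 := range_le_span_pair W hΩ hd (W.P_comm 0) hP0 hx hxP
  have hspan1 := range_le_span_pair W hΩ hd (W.P_comm 1) hP1 hy hyP
  obtain ⟨z', hz'⟩ := hzf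
  have hz'' : adMat k f *ᵥ (ι ∘ z') = ι ∘ z := by
    rw [adMat_mulVec_comp, ← hz']
    rfl
  have h1' : M *ᵥ (ι ∘ z) = adMat k f *ᵥ (M *ᵥ (ι ∘ z')) := by
    rw [← hz'', mulVec_mulVec, htf, ← mulVec_mulVec]
  have h1 : M *ᵥ (ι ∘ z) ∈ Submodule.span (Ad k) {ι ∘ z, ι ∘ (W.Ω *ᵥ z)} := by
    rw [h1']
    exact mulVec_adMat_mem_span W hspanf _
  obtain ⟨c, e, hce⟩ := Submodule.mem_span_pair.mp h1
  refine ⟨c, e, ?_⟩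
  set N : M4 k := M - (c • (1 : M4 k) + e • adMat k W.Ω) with hN
  have hcomm : ∀ A : Matrix (Fin 4) (Fin 4) k, M * adMat k A = adMat k A * M → A * W.Ω = W.Ω * A →
      N * adMat k A = adMat k A * N := by
    intro A hMA hAΩ
    have hΩA : adMat k W.Ω * adMat k A = adMat k A * adMat k W.Ω := by
      rw [← adMat_mul, ← hAΩ, adMat_mul]
    rw [hN, sub_mul, mul_sub, add_mul, mul_add, smul_mul_assoc, mul_smul_comm, one_mul, mul_one,
      smul_mul_assoc, mul_smul_comm, hMA, hΩA]
  have hcommΩ : N * adMat k W.Ω = adMat k W.Ω * N := hcomm W.Ω hMΩ rfl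
  have hNz : N *ᵥ (ι ∘ z) = 0 := by
    rw [hN, sub_mulVec, add_mulVec, smul_mulVec, one_mulVec, smul_mulVec, adMat_mulVec_comp, ← hce,
      sub_self]
  have hkill : ∀ (A : Matrix (Fin 4) (Fin 4) k), N * adMat k A = adMat k A * N →
      N *ᵥ (ι ∘ (A *ᵥ z)) = 0 := by
    intro A hNA
    rw [← adMat_mulVec_comp, mulVec_mulVec, hNA, ← mulVec_mulVec, hNz, mulVec_zero]
  have hkillΩ : ∀ v : Fin 4 → k, N *ᵥ (ι ∘ v) = 0 → N *ᵥ (ι ∘ (W.Ω *ᵥ v)) = 0 := by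
    intro v hv
    rw [← adMat_mulVec_comp, mulVec_mulVec, hcommΩ, ← mulVec_mulVec, hv, mulVec_zero]
  have hNx := hkill (W.P 0) (hcomm _ ht0 (W.P_comm 0))
  have hNy := hkill (W.P 1) (hcomm _ ht1 (W.P_comm 1))
  have hNΩx := hkillΩ _ hNx
  have hNΩy := hkillΩ _ hNy
  have hNP : ∀ (i : Fin 2) (v : Fin 4 → k),
      N *ᵥ (ι ∘ v) = 0 → N *ᵥ (ι ∘ (W.Ω *ᵥ v)) = 0 →
      LinearMap.range (W.P i).mulVecLin ≤ Submodule.span k {v, W.Ω *ᵥ v} →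
      N * adMat k (W.P i) = 0 := by
    intro i v hv hΩv hsp
    have key : ∀ w : Fin 4 → Ad k, (N * adMat k (W.P i)) *ᵥ w = 0 := by
      intro w
      rw [← mulVec_mulVec]
      obtain ⟨a, b, hab⟩ := Submodule.mem_span_pair.mp (mulVec_adMat_mem_span W hsp w)
      rw [← hab, mulVec_add, mulVec_smul, mulVec_smul, hv, hΩv, smul_zero, smul_zero, add_zero]
    ext i' j
    have h := congrFun (key (Pi.single j 1)) i'
    rw [mulVec_single_one] at h
    simpa using h
  have hNP0 := hNP 0 _ hNx hNΩx hspan0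
  have hNP1 := hNP 1 _ hNy hNΩy hspan1
  have hN0 : N = 0 := by
    have h := W.P_sum
    calc N = N * adMat k (W.P 0 + W.P 1) := by rw [h, adMat_one, mul_one]
      _ = N * adMat k (W.P 0) + N * adMat k (W.P 1) := by rw [adMat_add, mul_add]
      _ = 0 := by rw [hNP0, hNP1, add_zero]
  rw [hN] at hN0
  exact sub_eq_zero.mp hN0

/-- **linear regularity from a non-shared line** (v0.17 (ii)): if the rational line `g₀ Q₀ g₀'` conjugated by the
rational matrix `g₀` of `γ₀` is neither `P`-line, then `γ₀` is linearly regular. -/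
theorem isLinRegular_of_no_shared_line (hg : IsGenuineRow W) (γ₀ : rationalPoints W)
    (g₀ g₀' : Matrix (Fin 4) (Fin 4) k) (hg₀ : adMat k g₀ = GA.mat W (γ₀ : GA W)) (hinv : g₀ * g₀' = 1)
    (h0 : LinearMap.range (g₀ * W.Q 0 * g₀').mulVecLin ≠ LinearMap.range (W.P 0).mulVecLin)
    (h1 : LinearMap.range (g₀ * W.Q 0 * g₀').mulVecLin ≠ LinearMap.range (W.P 1).mulVecLin) :
    IsLinRegular W γ₀ := by
  obtain ⟨⟨d, hΩ, hd⟩, -, -, -, hPr, hQr⟩ := hg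
  intro Y Y' hYΩ hYP hY'Ω hY'Q hYγ
  have hinv' : g₀' * g₀ = 1 := mul_eq_one_comm.mp hinv
  have hA : adMat k g₀ * adMat k g₀' = 1 := by rw [← adMat_mul, hinv, adMat_one]
  have hA' : adMat k g₀' * adMat k g₀ = 1 := by rw [← adMat_mul, hinv', adMat_one]
  -- `g₀` and `g₀'` commute with `Ω`
  have hγΩ : adMat k g₀ * adMat k W.Ω = adMat k W.Ω * adMat k g₀ := by
    rw [hg₀]
    exact ((mem_unitaryGroup W _).mp (γ₀ : GA W).2).1
  have hg₀Ω : g₀ * W.Ω = W.Ω * g₀ := adMat_injective (by rw [adMat_mul, adMat_mul, hγΩ])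
  have hg₀'Ω : g₀' * W.Ω = W.Ω * g₀' := by
    calc g₀' * W.Ω = g₀' * W.Ω * (g₀ * g₀') := by rw [hinv, Matrix.mul_one]
      _ = g₀' * (g₀ * W.Ω) * g₀' := by rw [hg₀Ω]; simp only [Matrix.mul_assoc]
      _ = W.Ω * g₀' := by rw [← Matrix.mul_assoc, hinv', Matrix.one_mul]
  -- `Y' = g₀' Y g₀`
  have hY' : Y' = adMat k g₀' * Y * adMat k g₀ := by
    rw [← hg₀] at hYγ
    calc Y' = adMat k g₀' * (adMat k g₀ * Y') := by rw [← Matrix.mul_assoc, hA', Matrix.one_mul]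
      _ = adMat k g₀' * (Y * adMat k g₀) := by rw [hYγ]
      _ = adMat k g₀' * Y * adMat k g₀ := by rw [Matrix.mul_assoc]
  -- `Y` commutes with the conjugated projector
  have hYf : Y * adMat k (g₀ * W.Q 0 * g₀') = adMat k (g₀ * W.Q 0 * g₀') * Y := by
    have hq := hY'Q 0
    rw [hY'] at hq
    rw [adMat_mul, adMat_mul]
    calc Y * (adMat k g₀ * adMat k (W.Q 0) * adMat k g₀')
        = adMat k g₀ * ((adMat k g₀' * Y * adMat k g₀) * adMat k (W.Q 0)) * adMat k g₀' := by
          simp only [Matrix.mul_assoc]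
          rw [← Matrix.mul_assoc (adMat k g₀) (adMat k g₀'), hA, Matrix.one_mul]
      _ = adMat k g₀ * (adMat k (W.Q 0) * (adMat k g₀' * Y * adMat k g₀)) * adMat k g₀' := by rw [hq]
      _ = adMat k g₀ * adMat k (W.Q 0) * adMat k g₀' * Y := by
          simp only [Matrix.mul_assoc]
          rw [hA, Matrix.mul_one]
  -- the conjugated projector is a rank-2 `Ω`-stable matrix with a vector in general position
  have hfΩ : g₀ * W.Q 0 * g₀' * W.Ω = W.Ω * (g₀ * W.Q 0 * g₀') := by
    calc g₀ * W.Q 0 * g₀' * W.Ω = g₀ * W.Q 0 * (g₀' * W.Ω) := by simp only [Matrix.mul_assoc]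
      _ = g₀ * (W.Q 0 * W.Ω) * g₀' := by rw [hg₀'Ω]; simp only [Matrix.mul_assoc]
      _ = g₀ * (W.Ω * W.Q 0) * g₀' := by rw [W.Q_comm 0]
      _ = (g₀ * W.Ω) * W.Q 0 * g₀' := by simp only [Matrix.mul_assoc]
      _ = W.Ω * (g₀ * W.Q 0 * g₀') := by rw [hg₀Ω]; simp only [Matrix.mul_assoc]
  have hg₀det : IsUnit g₀.det := by
    have : g₀.det * g₀'.det = 1 := by rw [← Matrix.det_mul, hinv, Matrix.det_one]
    exact isUnit_iff_ne_zero.mpr (left_ne_zero_of_mul_eq_one this)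
  have hg₀'det : IsUnit g₀'.det := by
    have : g₀'.det * g₀.det = 1 := by rw [← Matrix.det_mul, hinv', Matrix.det_one]
    exact isUnit_iff_ne_zero.mpr (left_ne_zero_of_mul_eq_one this)
  have hfr : (g₀ * W.Q 0 * g₀').rank = 2 := by
    rw [Matrix.rank_mul_eq_left_of_isUnit_det _ _ hg₀'det, Matrix.rank_mul_eq_right_of_isUnit_det _ _ hg₀det]
    exact hQr 0
  obtain ⟨z, hzf, hx, hy⟩ := exists_mem_range_components_ne_zero W hΩ hd (hPr 0) (hPr 1) hfΩ hfr h0 h1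
  obtain ⟨c, e, hce⟩ := mat_eq_scalar_of_three_lines' W hΩ hd (hPr 0) (hPr 1) hfΩ hfr hzf hx hy Y hYΩ
    (hYP 0) (hYP 1) hYf
  refine ⟨c, e, hce, ?_⟩
  rw [hY', hce]
  simp only [mul_add, add_mul, mul_smul_comm, smul_mul_assoc, Matrix.mul_one]
  rw [hA', Matrix.mul_assoc, ← hγΩ, ← Matrix.mul_assoc, hA', Matrix.one_mul]

/-- **a linearly regular rational element exists** (J2.d′-i, v0.17 (B′)): for a definite row-genuine plane, some
rational point of `U(W)` is linearly regular — `1` when `im (Q 0)` is neither `P`-line, the rational rotation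
otherwise.  No Witt theorem, no density of rational points. -/
theorem exists_regular_rational (hW : IsDefinite W) (hg : IsGenuineRow W) :
    ∃ γ₀ : rationalPoints W, IsLinRegular W γ₀ := by
  classical
  obtain ⟨⟨d, hΩ, hd⟩, hrow, hPB, hQB, hPr, hQr⟩ := hg
  by_cases hgood : LinearMap.range (W.Q 0).mulVecLin ≠ LinearMap.range (W.P 0).mulVecLin ∧
      LinearMap.range (W.Q 0).mulVecLin ≠ LinearMap.range (W.P 1).mulVecLin
  · refine ⟨1, isLinRegular_of_no_shared_line W ⟨⟨d, hΩ, hd⟩, hrow, hPB, hQB, hPr, hQr⟩ 1 1 1 ?_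
      (Matrix.one_mul 1) ?_ ?_⟩
    · rw [adMat_one]
      rfl
    · simpa using hgood.1
    · simpa using hgood.2
  · have hbad : ∃ i : Fin 2,
        LinearMap.range (W.Q 0).mulVecLin = LinearMap.range (W.P i).mulVecLin := by
      rcases not_and_or.mp hgood with h | h
      · exact ⟨0, not_not.mp h⟩
      · exact ⟨1, not_not.mp h⟩
    obtain ⟨i, hi⟩ := hbad
    obtain ⟨γk, hγΩ, hγB, hγu, hγgen⟩ := exists_rational_rotation W hW hΩ hd hrow hPB hPr
    have hγdet : IsUnit γk.det := (Matrix.isUnit_iff_isUnit_det γk).mp hγu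
    have hγγ : γk * γk⁻¹ = 1 := Matrix.mul_nonsing_inv γk hγdet
    have hγγ' : γk⁻¹ * γk = 1 := Matrix.nonsing_inv_mul γk hγdet
    -- the lift to `G(𝔸_k)`
    set u : GL (Fin 4) k := hγu.unit with hudef
    have hu : (u : Matrix (Fin 4) (Fin 4) k) = γk := hγu.unit_spec
    set g : GL4 k := Matrix.GeneralLinearGroup.map (algebraMap k (Ad k)) u with hgdef
    have hgm : (g : M4 k) = adMat k γk := by
      ext a b
      rw [hgdef]
      show (algebraMap k (Ad k)) (u a b) = (adMat k γk) a b
      rw [adMat, Matrix.map_apply, ← hu]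
    have hgmem : g ∈ unitaryGroup W := by
      rw [mem_unitaryGroup, hgm]
      constructor
      · rw [← adMat_mul, ← adMat_mul, hγΩ]
      · rw [← adMat_transpose, ← adMat_mul, ← adMat_mul, hγB]
    set γ : GA W := ⟨g, hgmem⟩ with hγdef
    have hγrat : γ ∈ rationalPoints W := by
      rw [rationalPoints, Subgroup.mem_subgroupOf]
      exact ⟨u, rfl⟩
    refine ⟨⟨γ, hγrat⟩, isLinRegular_of_no_shared_line W ⟨⟨d, hΩ, hd⟩, hrow, hPB, hQB, hPr, hQr⟩
      ⟨γ, hγrat⟩ γk γk⁻¹ hgm.symm hγγ ?_ ?_⟩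
    all_goals
      -- a vector of the conjugated line with both components non-zero
      have hneQ : LinearMap.range (W.Q 0).mulVecLin ≠ ⊥ := by
        intro h
        have h2 : Module.finrank k (LinearMap.range (W.Q 0).mulVecLin) = 2 := hQr 0
        rw [h, finrank_bot] at h2
        exact absurd h2 (by norm_num)
      obtain ⟨q, hqQ, hq0⟩ := Submodule.exists_mem_ne_zero_of_ne_bot hneQ
      have hqP : q ∈ LinearMap.range (W.P i).mulVecLin := hi ▸ hqQ
      obtain ⟨hz0, hz1⟩ := hγgen i q hqP hq0
      have hzf : γk *ᵥ q ∈ LinearMap.range (γk * W.Q 0 * γk⁻¹).mulVecLin := by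
        obtain ⟨q', hq'⟩ := hqQ
        simp only [mulVecLin_apply] at hq'
        refine ⟨γk *ᵥ q', ?_⟩
        simp only [mulVecLin_apply]
        rw [mulVec_mulVec, Matrix.mul_assoc, Matrix.mul_assoc, hγγ', Matrix.mul_one, ← mulVec_mulVec, hq']
      have h10 : W.P 1 * W.P 0 = 0 := by
        have h := W.P_sum
        have : W.P 1 = 1 - W.P 0 := by rw [← h]; abel
        rw [this, sub_mul, one_mul, W.P_idem 0, sub_self]
      have h01 : W.P 0 * W.P 1 = 0 := by
        have h := W.P_sum
        have : W.P 0 = 1 - W.P 1 := by rw [← h]; abel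
        rw [this, sub_mul, one_mul, W.P_idem 1, sub_self]
      intro heq
      rw [heq] at hzf
      obtain ⟨w, hw⟩ := hzf
      simp only [mulVecLin_apply] at hw
      first
      | exact hz1 (by rw [← hw, mulVec_mulVec, h10, zero_mulVec])
      | exact hz0 (by rw [← hw, mulVec_mulVec, h01, zero_mulVec])

end Summit.Ventures.HodgeRepro.Tier4.Line1
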